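import Literature.NumberTheory.Automorphic.JacquetModule

/-!
# Frobenius reciprocity for normalised parabolic induction
(proof of `Representation.frobenius_normalizedInd`)

This file discharges the named fact `Representation.frobenius_normalizedInd` of
`Literature.NumberTheory.Automorphic.JacquetModule` (Bernstein–Zelevinsky 1977, Proposition 1.9(b),
p. 445, in the case `θ = 1`): for a parabolic triple `t = (P, M, N)` in a topological group `G`
whose modulus character `δ_P` is trivial on `N`, a smooth representation `π` of `G` and a
representation `σ` of `M`,

  `Hom_G (π, i_P^G σ) ≃ₗ[ℂ] Hom_M (r_P^G π, σ)`,

where `i_P^G σ = Ind_P^G (σ ∘ proj ⊗ δ_P^{1/2})` (`Representation.normalizedInd`) and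
`r_P^G π = π_N ⊗ δ_P^{-1/2}` (`Representation.normalizedJacquet`).

## Proof

As indicated in Bernstein–Zelevinsky 1977, 1.9 (p. 445: the assertions "are proved in [1],
chap. I; since the definitions in [1] don't include the factor `mod^{1/2}`, in (b), (c) and (d)
one has to verify that all such factors are compatible"), the isomorphism is the composite of

1. Frobenius reciprocity for smooth induction (`Representation.frobeniusEquiv` of
   `Literature.NumberTheory.Automorphic.SmoothInduction`, Bernstein–Zelevinsky 1976,
   Proposition 2.28): `Hom_G (π, Ind_P^G τ) ≃ₗ Hom_P (π|_P, τ)` for `π` smooth, with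
   `τ = σ ∘ proj ⊗ δ_P^{1/2}`;
2. the compatibility of the twists (`Representation.normalizedJacquetHomEquiv`):
   `Hom_P (π|_P, σ ∘ proj ⊗ δ_P^{1/2}) ≃ₗ Hom_M (π_N ⊗ δ_P^{-1/2}, σ)`. A `P`-map
   `φ : π|_P → τ` satisfies `φ (π n v) = δ_P^{1/2}(n) σ(proj n) φ v = φ v` for `n ∈ N` (here
   `δ_P|_N = 1` is used), so it factors through the `N`-coinvariants
   (`Representation.Coinvariants.lift`), and for `m ∈ M` the factor `δ_P^{1/2}(m)` coming from
   `τ` cancels against the `δ_P^{-1/2}(m)` of the normalised Jacquet module. Conversely an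
   `M`-map `ψ : π_N ⊗ δ_P^{-1/2} → σ` gives `v ↦ ψ [v]`, which is `P`-equivariant into `τ` by
   writing `p = m n` with `m = proj p`, `n ∈ N` (`[π n v] = [v]`) and
   `δ_P^{1/2}(p) = δ_P^{1/2}(proj p)` (`Literature.NumberTheory.Automorphic.rootDeltaChar_eq_rootDeltaChar_inclusion_proj`,
   again from `δ_P|_N = 1`).

## Main declarations

* `Literature.NumberTheory.Automorphic.ParabolicTriple.proj_inclusion`: `proj m = m` for `m ∈ M`;
* `Literature.NumberTheory.Automorphic.rootDeltaChar_eq_rootDeltaChar_inclusion_proj`: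
  `δ_P^{1/2}(p) = δ_P^{1/2}(proj p)` when `δ_P|_N = 1`;
* `Representation.normalizedJacquetLift`, `Representation.normalizedJacquetDesc`,
  `Representation.normalizedJacquetHomEquiv` — step 2;
* `Representation.frobenius_normalizedInd_holds : frobenius_normalizedInd` — the discharge.

## References

* I. N. Bernstein, A. V. Zelevinsky, *Induced representations of reductive `p`-adic groups I*,
  Ann. Sci. ÉNS 10 (1977), 441–472: §1.8 (p. 444, the functors `i_{U,θ}`, `I_{U,θ}`, `r_{U,θ}`
  with the factors `mod_U^{± 1/2}`) and Proposition 1.9(b) (p. 445: "The functor `r_{U,θ}` is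
  left adjoint to `I_{U,θ}`, i.e. for any `ρ ∈ Alg M`, `π ∈ Alg G` there is a natural
  isomorphism `Hom (r_{U,θ}(π), ρ) = Hom (π, I_{U,θ}(ρ))`").
* I. N. Bernstein, A. V. Zelevinsky, *Representations of the group `GL(n, F)` where `F` is a
  non-archimedean local field*, Russian Math. Surveys 31 (1976), Proposition 2.28.
* W. Casselman, *Introduction to the theory of admissible representations of `p`-adic reductive
  groups* (1995 notes), Thm. 3.2.4.
-/

open Literature.NumberTheory.Automorphic

/-! ### The Levi projection and the modulus character -/

namespace Literature.NumberTheory.Automorphic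

namespace ParabolicTriple

variable {G : Type*} [Group G] (t : ParabolicTriple G)

/-- The Levi projection restricted to `M` (along `Subgroup.inclusion`) is the identity:
`proj m = m`. (Bernstein–Zelevinsky 1977, §1.8.) [folklore] -/
@[simp] theorem proj_inclusion (m : t.M) : t.proj (Subgroup.inclusion t.M_le m) = m :=
  Subtype.ext (t.proj_apply_of_mem_M _ m.2)

/-- `p = proj p · ((proj p)⁻¹ p)` in `P`. [folklore] -/
theorem inclusion_proj_mul_inv_mul (p : t.P) :
    Subgroup.inclusion t.M_le (t.proj p) * ((Subgroup.inclusion t.M_le (t.proj p))⁻¹ * p) = p :=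
  mul_inv_cancel_left _ _

/-- The second factor `(proj p)⁻¹ p` of the decomposition `p = m n` lies in `N`. [folklore] -/
theorem coe_inclusion_proj_inv_mul_mem (p : t.P) :
    (((Subgroup.inclusion t.M_le (t.proj p))⁻¹ * p : t.P) : G) ∈ t.N :=
  t.proj_inv_mul_mem p

end ParabolicTriple

section Modulus

variable {G : Type*} [Group G] [TopologicalSpace G] [IsTopologicalGroup G]
  (t : ParabolicTriple G) [LocallyCompactSpace t.P]

/-- If `δ_P` is trivial on `N` then `δ_P^{1/2}(p) = δ_P^{1/2}(proj p)`: write `p = m n` with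
`m = proj p ∈ M`, `n ∈ N`, and use `δ_P^{1/2}(n) = 1`. (Bernstein–Zelevinsky 1977, 1.8–1.9: the
factor `mod_U^{1/2}` only depends on the `M`-component.) [folklore] -/
theorem rootDeltaChar_eq_rootDeltaChar_inclusion_proj
    (hδ : ∀ (n : G) (hn : n ∈ t.N), deltaChar t.P ⟨n, t.N_le hn⟩ = 1) (p : t.P) :
    rootDeltaChar t.P p = rootDeltaChar t.P (Subgroup.inclusion t.M_le (t.proj p)) := by
  have h1 : rootDeltaChar t.P ((Subgroup.inclusion t.M_le (t.proj p))⁻¹ * p) = 1 :=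
    rootDeltaChar_eq_one_of_deltaChar_eq_one t.P (hδ _ (t.coe_inclusion_proj_inv_mul_mem p))
  conv_lhs => rw [← t.inclusion_proj_mul_inv_mul p]
  rw [map_mul, h1, mul_one]

end Modulus

end Literature.NumberTheory.Automorphic

/-! ### Compatibility of the twists `δ_P^{± 1/2}` -/

namespace Representation

section TwistCompat

variable {G : Type*} [Group G] [TopologicalSpace G] [IsTopologicalGroup G]
  (t : ParabolicTriple G) [LocallyCompactSpace t.P]
  {V W : Type*} [AddCommGroup V] [Module ℂ V] [AddCommGroup W] [Module ℂ W]
  (π : Representation ℂ G V) (σ : Representation ℂ t.M W)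

/-- If `δ_P|_N = 1`, a `P`-intertwining map `φ : π|_P → σ ∘ proj ⊗ δ_P^{1/2}` is invariant under
`N`: `φ (π n v) = δ_P^{1/2}(n) σ(proj n) (φ v) = φ v`. [folklore] -/
theorem apply_restrict_apply_eq
    (hδ : ∀ (n : G) (hn : n ∈ t.N), deltaChar t.P ⟨n, t.N_le hn⟩ = 1)
    (φ : IntertwiningMap (π.comp t.P.subtype) (Representation.twist (σ.comp t.proj) (rootDeltaChar t.P)))
    (n : ↥(t.N.subgroupOf t.P)) (v : V) :
    φ (t.restrict π n v) = φ v := by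
  have hn : ((n : t.P) : G) ∈ t.N := Subgroup.mem_subgroupOf.1 n.2
  have h1 : rootDeltaChar t.P (n : t.P) = 1 :=
    rootDeltaChar_eq_one_of_deltaChar_eq_one t.P (hδ _ hn)
  have h := IntertwiningMap.isIntertwining _ _ φ (n : t.P) v
  simp only [twist_apply, MonoidHom.comp_apply] at h
  rw [t.proj_apply_of_mem_N _ hn, map_one, h1, Units.val_one, one_smul,
    Module.End.one_apply] at h
  exact h

/-- For an `M`-intertwining map `ψ : π_N ⊗ δ_P^{-1/2} → σ`:
`ψ [π m w] = δ_P^{1/2}(m) σ(m) (ψ [w])`. [folklore] -/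
theorem apply_mk_apply_eq (ψ : (π.normalizedJacquet t).IntertwiningMap σ) (m : t.M) (w : V) :
    ψ (Coinvariants.mk (t.restrict π) (π (m : G) w)) =
      ((rootDeltaChar t.P (Subgroup.inclusion t.M_le m) : ℂˣ) : ℂ) •
        σ m (ψ (Coinvariants.mk (t.restrict π) w)) := by
  have h := IntertwiningMap.isIntertwining _ _ ψ m (Coinvariants.mk (t.restrict π) w)
  rw [normalizedJacquet_mk, map_smul] at h
  rw [← h, smul_smul, Units.mul_inv, one_smul]

variable {t π σ} in
/-- Step 2, forward: if `δ_P|_N = 1`, a `P`-map `φ : π|_P → σ ∘ proj ⊗ δ_P^{1/2}` factors through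
the `N`-coinvariants (`Representation.Coinvariants.lift`) to an `M`-map
`π_N ⊗ δ_P^{-1/2} → σ`, `[v] ↦ φ v`; the factors `δ_P^{∓ 1/2}(m)` cancel.
(Bernstein–Zelevinsky 1977, 1.9, compatibility of the factors `mod^{1/2}`, p. 445.) [folklore] -/
noncomputable def normalizedJacquetLift
    (hδ : ∀ (n : G) (hn : n ∈ t.N), deltaChar t.P ⟨n, t.N_le hn⟩ = 1)
    (φ : IntertwiningMap (π.comp t.P.subtype) (Representation.twist (σ.comp t.proj) (rootDeltaChar t.P))) :
    (π.normalizedJacquet t).IntertwiningMap σ where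
  toLinearMap := Coinvariants.lift (t.restrict π) φ.toLinearMap fun n => by
    apply LinearMap.ext
    intro v
    exact apply_restrict_apply_eq t π σ hδ φ n v
  isIntertwining' m := by
    refine Coinvariants.hom_ext ?_
    apply LinearMap.ext
    intro v
    simp only [LinearMap.coe_comp, Function.comp_apply]
    rw [normalizedJacquet_mk, map_smul, Coinvariants.lift_mk, Coinvariants.lift_mk,
      IntertwiningMap.toLinearMap_apply, IntertwiningMap.toLinearMap_apply]
    have h := IntertwiningMap.isIntertwining _ _ φ (Subgroup.inclusion t.M_le m) v
    simp only [twist_apply, MonoidHom.comp_apply, t.proj_inclusion] at h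
    change φ (π (m : G) v) = _ at h
    change _ • φ (π (m : G) v) = σ m (φ v)
    rw [h, smul_smul, Units.inv_mul, one_smul]

/-- `normalizedJacquetLift hδ φ [v] = φ v`. [folklore] -/
@[simp] theorem normalizedJacquetLift_mk
    (hδ : ∀ (n : G) (hn : n ∈ t.N), deltaChar t.P ⟨n, t.N_le hn⟩ = 1)
    (φ : IntertwiningMap (π.comp t.P.subtype) (Representation.twist (σ.comp t.proj) (rootDeltaChar t.P)))
    (v : V) :
    normalizedJacquetLift hδ φ (Coinvariants.mk (t.restrict π) v) = φ v := rfl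

variable {t π σ} in
/-- Step 2, backward: if `δ_P|_N = 1`, an `M`-map `ψ : π_N ⊗ δ_P^{-1/2} → σ` gives the `P`-map
`v ↦ ψ [v]` into `σ ∘ proj ⊗ δ_P^{1/2}`: for `p = m n` (`m = proj p`, `n ∈ N`) one has
`[π p v] = [π m (π n v)]`, `[π n v] = [v]`, and `δ_P^{1/2}(p) = δ_P^{1/2}(m)`.
(Bernstein–Zelevinsky 1977, 1.9, compatibility of the factors `mod^{1/2}`, p. 445.) [folklore] -/
noncomputable def normalizedJacquetDesc
    (hδ : ∀ (n : G) (hn : n ∈ t.N), deltaChar t.P ⟨n, t.N_le hn⟩ = 1)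
    (ψ : (π.normalizedJacquet t).IntertwiningMap σ) :
    IntertwiningMap (π.comp t.P.subtype) (Representation.twist (σ.comp t.proj) (rootDeltaChar t.P)) where
  toLinearMap := ψ.toLinearMap ∘ₗ Coinvariants.mk (t.restrict π)
  isIntertwining' p := by
    apply LinearMap.ext
    intro v
    have hmk : Coinvariants.mk (t.restrict π)
          (π (((Subgroup.inclusion t.M_le (t.proj p))⁻¹ * p : t.P) : G) v) =
        Coinvariants.mk (t.restrict π) v :=
      Coinvariants.mk_self_apply (t.restrict π)
        ⟨_, Subgroup.mem_subgroupOf.2 (t.coe_inclusion_proj_inv_mul_mem p)⟩ v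
    have hπp : π (p : G) v = π ((Subgroup.inclusion t.M_le (t.proj p) : t.P) : G)
        (π (((Subgroup.inclusion t.M_le (t.proj p))⁻¹ * p : t.P) : G) v) := by
      rw [← Module.End.mul_apply, ← map_mul, ← Subgroup.coe_mul, t.inclusion_proj_mul_inv_mul]
    change ψ (Coinvariants.mk (t.restrict π) (π (p : G) v)) =
      ((rootDeltaChar t.P p : ℂˣ) : ℂ) • σ (t.proj p) (ψ (Coinvariants.mk (t.restrict π) v))
    rw [hπp, Subgroup.coe_inclusion, apply_mk_apply_eq t π σ ψ, hmk,
      rootDeltaChar_eq_rootDeltaChar_inclusion_proj t hδ p]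

/-- `normalizedJacquetDesc hδ ψ v = ψ [v]`. [folklore] -/
@[simp] theorem normalizedJacquetDesc_apply
    (hδ : ∀ (n : G) (hn : n ∈ t.N), deltaChar t.P ⟨n, t.N_le hn⟩ = 1)
    (ψ : (π.normalizedJacquet t).IntertwiningMap σ) (v : V) :
    normalizedJacquetDesc hδ ψ v = ψ (Coinvariants.mk (t.restrict π) v) := rfl

/-- **Step 2 of Frobenius reciprocity for normalised induction**: if `δ_P|_N = 1` then
`Hom_P (π|_P, σ ∘ proj ⊗ δ_P^{1/2}) ≃ₗ[ℂ] Hom_M (π_N ⊗ δ_P^{-1/2}, σ)`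
(`normalizedJacquetLift` and `normalizedJacquetDesc` are mutually inverse: both composites are
the identity on underlying linear maps, the second by the universal property of coinvariants).
(Bernstein–Zelevinsky 1977, Proposition 1.9(b) and the remark after it on the compatibility of
the factors `mod^{1/2}`, p. 445.) [cite: BernsteinZelevinsky1977, Proposition 1.9(b), p. 445] -/
noncomputable def normalizedJacquetHomEquiv
    (hδ : ∀ (n : G) (hn : n ∈ t.N), deltaChar t.P ⟨n, t.N_le hn⟩ = 1) :
    IntertwiningMap (π.comp t.P.subtype) (Representation.twist (σ.comp t.proj) (rootDeltaChar t.P)) ≃ₗ[ℂ]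
      (π.normalizedJacquet t).IntertwiningMap σ where
  toFun := normalizedJacquetLift hδ
  invFun := normalizedJacquetDesc hδ
  map_add' φ₁ φ₂ := by
    apply IntertwiningMap.ext
    refine Coinvariants.hom_ext ?_
    apply LinearMap.ext
    intro v
    rfl
  map_smul' c φ := by
    apply IntertwiningMap.ext
    refine Coinvariants.hom_ext ?_
    apply LinearMap.ext
    intro v
    rfl
  left_inv φ := by
    apply IntertwiningMap.ext
    apply LinearMap.ext
    intro v
    rfl
  right_inv ψ := by
    apply IntertwiningMap.ext
    refine Coinvariants.hom_ext ?_
    apply LinearMap.ext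
    intro v
    rfl

/-- `normalizedJacquetHomEquiv` is `normalizedJacquetLift`. [folklore] -/
@[simp] theorem normalizedJacquetHomEquiv_apply
    (hδ : ∀ (n : G) (hn : n ∈ t.N), deltaChar t.P ⟨n, t.N_le hn⟩ = 1)
    (φ : IntertwiningMap (π.comp t.P.subtype) (Representation.twist (σ.comp t.proj) (rootDeltaChar t.P))) :
    normalizedJacquetHomEquiv t π σ hδ φ = normalizedJacquetLift hδ φ := rfl

/-- The inverse of `normalizedJacquetHomEquiv` is `normalizedJacquetDesc`. [folklore] -/
@[simp] theorem normalizedJacquetHomEquiv_symm_apply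
    (hδ : ∀ (n : G) (hn : n ∈ t.N), deltaChar t.P ⟨n, t.N_le hn⟩ = 1)
    (ψ : (π.normalizedJacquet t).IntertwiningMap σ) :
    (normalizedJacquetHomEquiv t π σ hδ).symm ψ = normalizedJacquetDesc hδ ψ := rfl

end TwistCompat

/-! ### The discharge -/

section Frobenius

variable {G : Type*} [Group G] [TopologicalSpace G] [IsTopologicalGroup G]

/-- **Discharge of `Representation.frobenius_normalizedInd`** (Frobenius reciprocity for
normalised parabolic induction): for a parabolic triple `t = (P, M, N)` with `δ_P|_N = 1`, a
smooth representation `π` of `G` and a representation `σ` of `M`,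
`Hom_G (π, i_P^G σ) ≃ₗ[ℂ] Hom_M (r_P^G π, σ)`, the composite of Frobenius reciprocity for smooth
induction (`Representation.frobeniusEquiv`, Bernstein–Zelevinsky 1976, Prop. 2.28) with the
compatibility of the factors `δ_P^{± 1/2}` (`normalizedJacquetHomEquiv`).
(Bernstein–Zelevinsky 1977, Proposition 1.9(b), p. 445, case `θ = 1`; Casselman 1995, Thm. 3.2.4.)
[cite: BernsteinZelevinsky1977, Proposition 1.9(b), p. 445] -/
theorem frobenius_normalizedInd_holds : frobenius_normalizedInd (G := G) := by
  intro V W _ _ _ _ t _ hδ π σ hπ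
  exact ⟨(Representation.frobeniusEquiv (H := t.P)
    (σ := Representation.twist (σ.comp t.proj) (rootDeltaChar t.P)) hπ).trans
      (normalizedJacquetHomEquiv t π σ hδ)⟩

end Frobenius

end Representation
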